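import Summits.QuantumFields.BalabanUV.T4Continuum.Support.NE7K1LinTwoRunKit

/-!
# NE7K1LinTwoRunBonds — row NE7 (node U5), candidate route HOM, path H1L, cell K1-lin(s): TWO-RUN COMPARISON AT `A = 0`,
# the BOND-ENERGY BOOKKEEPING for the lower half — block Poincaré on the fine side, one crossing bond per coarse
# nearest-neighbour pair, and `Σ_xΣ_{y~x}(V_x − V_y)² ≤ (6(d+1)L² + 6)·Σ_k(φ(k₊) − φ(k₋))²` for block means `V` of `φ`

Lineage `b2b-balaban-t4-ne7-p2` (CRUX PROVER NE7 #2), generation 64; consumed by `NE7K1LinTwoRunLower` (the lower half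
`c₁·P_A ≤ P_B^{Schur}` of the comparability that `NE7K1LinSchurLineDerivRel`'s η-uniform `∂_s` letter needs).  Objects of
`NE7K1LinSchurLineU1` ∕ `NE7K1LinTwoRunKit`: `R′` a union of `L`-blocks, `R = R′.image (blk L)`, fine bonds `k : RBond R′` with
end-points `k₋ = rsrc k`, `k₊ = rtgt k` (`B4Lower18`).  All [folklore]:

* §1 the fine side: block Poincaré on every `L`-block of `R′` with constant `L²∕2` (`blockPoincare_fine` — the `hPoin` of
  `B4Lower18.lower18_zero`); the Dirichlet part of a region's nearest-neighbour form DOMINATES `m²×` its bond energy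
  (`bondEnergy_le_dirichletPart`, from `Beta.BlockPoincare.lap_form_ge_dirichlet`).
* §2 the coarse side: degree bound `2(d+1)` (`card_nbr_le`, `sum_nbr_left_le`, `sum_nbr_right_le`); the block energies add
  up to at most the total bond energy (`sum_blockEnergy_le`), the crossing energies over ordered pairs to at most twice it
  (`sum_crossEnergy_le`); for coarse nearest neighbours `x ~ y` there IS a fine bond crossing between the two blocks
  (`exists_cross_bond`: from `L•x + (L−1)e_i` to `L•(x+e_i)`, `finePt_last_add_uvec`); a fine function with `L`-block sums
  `L^{d+1}V_b` has block means `V_b` (`avg_block_eq`), one point against its block mean costs `(L²∕2)·E_b` (`sq_sub_blockMean_le`),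
  hence THE PAIR BOUND `(V_x − V_y)² ≤ 3((L²∕2)(E_x + E_y) + E_{x,y})` (`pair_sq_le`) and, summing,
  **`coarseDirichlet_le`**: `Σ_xΣ_{y~x}(V_x − V_y)² ≤ (6(d+1)L² + 6)·Σ_k(φ(k₊) − φ(k₋))²`.
  (Crude: the natural route — (d+1)-dimensional Jensen along straight `L`-step lines — gives `2L^{1−d}`; this one trades the
  constant for a short proof; everything depends on `d, L` only.)

HONEST FRAMING: Gaussian `A = 0`, finite regions, [folklore] over the tree's `B4Lower18` ∕ `Beta.BlockPoincare` certificates;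
nothing printed asserted; no `sorry`.  FIXED FINITE T⁴, rung (B)+1; NE7 NOT PRINTED ∕ NOT PROVED; spine 0∕9; NOT infinite volume,
NOT mass gap, NOT Clay.  HONEST DEPENDENCY: continuum YM on T⁴ ⇐ BetaPertH ∧ nine spine estimates (0/9 proved); BetaPertH ⇐
(D1) ∧ (D4) ∧ CAP+tail; G-an2-4 gates asym, D1 and NE2/3/4.
-/

noncomputable section

open Finset Matrix

namespace Summit.QuantumFields.BalabanUV.T4Continuum.NE7K1LinTwoRunBonds

open Literature.MathematicalPhysics.QuantumFieldTheory.Balaban1983to89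
open Literature.MathematicalPhysics.QuantumFieldTheory.Balaban1983to89.B4Reflection242
open Literature.MathematicalPhysics.QuantumFieldTheory.Balaban1983to89.B4BoxCov237
open Literature.MathematicalPhysics.QuantumFieldTheory.Balaban1983to89.B4Lower18
open Literature.MathematicalPhysics.QuantumFieldTheory.Balaban1983to89.B4Thm110ZeroBox (blk_blk)
open Literature.MathematicalPhysics.QuantumFieldTheory.Balaban1983to89.Beta.BlockPoincare (avg lap_form_ge_dirichlet)
open NE7K1LinSchurLineForm NE7K1LinSchurLineCoords NE7K1LinBlockCoords NE7K1LinSchurLineU1 NE7K1LinTwoRunKit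

variable {d : ℕ}

/-! ### §1 The fine side: block Poincaré and the bond energy -/

section Fine

variable {L : ℕ} [NeZero L] {R' : Finset (Fin (d + 1) → ℤ)}

/-- the bond energy of a fine function inside one `L`-block. [folklore] -/
theorem blockPoincare_fine (hR'L : IsBlockUnion L R') (b : ↥(R'.image (blk L))) (f : ↥R' → ℝ) :
    ∑ i ∈ Finset.univ.filter (fun i => rblk L R' i = b), (f i - avg (Finset.univ.filter fun i => rblk L R' i = b) f) ^ 2 ≤
      (L : ℝ) ^ 2 / 2 * ∑ k ∈ Finset.univ.filter (fun k : RBond R' => rblk L R' (rsrc k) = b ∧ rblk L R' (rtgt k) = b),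
        (f (rtgt k) - f (rsrc k)) ^ 2 := by
  classical
  obtain ⟨ℓ, hℓL⟩ : ∃ ℓ, L = ℓ + 1 := ⟨L - 1, by have := NeZero.one_le (n := L); omega⟩
  subst hℓL
  have hnonneg : 0 ≤ ∑ k ∈ Finset.univ.filter
      (fun k : RBond R' => rblk (ℓ + 1) R' (rsrc k) = b ∧ rblk (ℓ + 1) R' (rtgt k) = b), (f (rtgt k) - f (rsrc k)) ^ 2 :=
    Finset.sum_nonneg fun _ _ => sq_nonneg _
  rcases Nat.eq_zero_or_pos ℓ with rfl | hℓ
  · rw [rblock_var_eq_zero_one hR'L b f]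
    positivity
  · refine (rblock_poincare hℓ hR'L b f).trans (mul_le_mul_of_nonneg_right ?_ hnonneg)
    push_cast
    nlinarith [(Nat.cast_nonneg ℓ : (0 : ℝ) ≤ ℓ)]

/-- **THE DIRICHLET PART OF A REGION'S FORM DOMINATES `m²×` ITS BOND ENERGY** (each unordered bond appears twice in the
ordered nearest-neighbour sum). [folklore] -/
theorem bondEnergy_le_dirichletPart (m : ℕ) (R : Finset (Fin (d + 1) → ℤ)) (φ : ↥R → ℝ) :
    ((m : ℝ)) ^ 2 * ∑ k : RBond R, (φ (rtgt k) - φ (rsrc k)) ^ 2 ≤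
      (m : ℝ) ^ 2 / 2 * ∑ x : ↥R, ∑ y : ↥R, (if y.1 ∈ nbrs x.1 then (φ x - φ y) ^ 2 else 0) := by
  have h := lap_form_ge_dirichlet (adjC m R) (adjC_symm m R) (adjC_nonneg m R) rsrc rtgt ((m : ℝ) ^ 2)
    (fun k => (adjC_bond m k).ge) (rbond_injective R) (rbond_anti R) φ
  have h1 : ∑ x : ↥R, ∑ y : ↥R, adjC m R x y * (φ x - φ y) ^ 2 =
      (m : ℝ) ^ 2 * ∑ x : ↥R, ∑ y : ↥R, (if y.1 ∈ nbrs x.1 then (φ x - φ y) ^ 2 else 0) := by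
    rw [Finset.mul_sum]
    refine Finset.sum_congr rfl fun x _ => ?_
    rw [Finset.mul_sum]
    refine Finset.sum_congr rfl fun y _ => ?_
    unfold adjC
    split_ifs <;> ring
  rw [h1] at h
  linarith

end Fine

/-! ### §2 The coarse side: one crossing bond per coarse nearest-neighbour pair -/

section Coarse

variable {L : ℕ} {R' : Finset (Fin (d + 1) → ℤ)}

/-- the block energy `E_b = Σ_{k inside b}(φ(k₊) − φ(k₋))²` is non-negative. [folklore] -/
theorem blockEnergy_nonneg (φ : ↥R' → ℝ) (b : ↥(R'.image (blk L))) :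
    0 ≤ ∑ k ∈ Finset.univ.filter (fun k : RBond R' => rblk L R' (rsrc k) = b ∧ rblk L R' (rtgt k) = b),
      (φ (rtgt k) - φ (rsrc k)) ^ 2 :=
  Finset.sum_nonneg fun _ _ => sq_nonneg _

/-- the coarse degree bound: at most `2(d+1)` neighbours. [folklore] -/
theorem card_nbr_le (R : Finset (Fin (d + 1) → ℤ)) (x : ↥R) :
    ((Finset.univ.filter fun y : ↥R => y.1 ∈ nbrs x.1).card : ℝ) ≤ 2 * ((d : ℝ) + 1) := by
  have h2 : (Finset.univ.filter fun y : ↥R => y.1 ∈ nbrs x.1).card = ((nbrs x.1).filter fun z => z ∈ R).card := by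
    rw [← Finset.card_subtype (fun z => z ∈ R) (nbrs x.1)]
    congr 1
    ext l
    simp [Finset.mem_subtype]
  have h3 : ((nbrs x.1).filter fun z => z ∈ R).card ≤ 2 * (d + 1) :=
    (Finset.card_filter_le _ _).trans (card_nbrs x.1).le
  have h4 : (Finset.univ.filter fun y : ↥R => y.1 ∈ nbrs x.1).card ≤ 2 * (d + 1) := h2 ▸ h3
  exact_mod_cast h4

/-- `Σ_x Σ_{y~x} G(x) ≤ 2(d+1)·Σ_x G(x)` for `G ≥ 0`. [folklore] -/
theorem sum_nbr_left_le (R : Finset (Fin (d + 1) → ℤ)) (G : ↥R → ℝ) (hG : ∀ x, 0 ≤ G x) :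
    ∑ x : ↥R, ∑ y : ↥R, (if y.1 ∈ nbrs x.1 then G x else 0) ≤ 2 * ((d : ℝ) + 1) * ∑ x : ↥R, G x := by
  rw [Finset.mul_sum]
  refine Finset.sum_le_sum fun x _ => ?_
  rw [← Finset.sum_filter, Finset.sum_const, nsmul_eq_mul]
  exact mul_le_mul_of_nonneg_right (card_nbr_le R x) (hG x)

/-- `Σ_x Σ_{y~x} G(y) ≤ 2(d+1)·Σ_y G(y)` for `G ≥ 0` (symmetry of the neighbour relation). [folklore] -/
theorem sum_nbr_right_le (R : Finset (Fin (d + 1) → ℤ)) (G : ↥R → ℝ) (hG : ∀ x, 0 ≤ G x) :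
    ∑ x : ↥R, ∑ y : ↥R, (if y.1 ∈ nbrs x.1 then G y else 0) ≤ 2 * ((d : ℝ) + 1) * ∑ x : ↥R, G x := by
  rw [Finset.sum_comm]
  have : ∀ y : ↥R, ∑ x : ↥R, (if y.1 ∈ nbrs x.1 then G y else 0) = ∑ x : ↥R, (if x.1 ∈ nbrs y.1 then G y else 0) :=
    fun y => Finset.sum_congr rfl fun x _ => by
      by_cases h : y.1 ∈ nbrs x.1
      · rw [if_pos h, if_pos (nbrs_comm.1 h)]
      · rw [if_neg h, if_neg (fun h' => h (nbrs_comm.1 h'))]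
  simp_rw [this]
  exact sum_nbr_left_le R G hG

/-- the block energies add up to at most the total bond energy. [folklore] -/
theorem sum_blockEnergy_le (φ : ↥R' → ℝ) :
    ∑ b : ↥(R'.image (blk L)), ∑ k ∈ Finset.univ.filter
        (fun k : RBond R' => rblk L R' (rsrc k) = b ∧ rblk L R' (rtgt k) = b), (φ (rtgt k) - φ (rsrc k)) ^ 2 ≤
      ∑ k : RBond R', (φ (rtgt k) - φ (rsrc k)) ^ 2 := by
  classical
  simp_rw [Finset.sum_filter]
  rw [Finset.sum_comm]
  refine Finset.sum_le_sum fun k _ => ?_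
  rw [← Finset.sum_filter]
  have hsub : (Finset.univ.filter fun b : ↥(R'.image (blk L)) => rblk L R' (rsrc k) = b ∧ rblk L R' (rtgt k) = b) ⊆
      {rblk L R' (rsrc k)} := by
    intro b hb
    simp only [Finset.mem_filter, Finset.mem_univ, true_and] at hb
    rw [Finset.mem_singleton, hb.1]
  calc ∑ b ∈ Finset.univ.filter (fun b : ↥(R'.image (blk L)) => rblk L R' (rsrc k) = b ∧ rblk L R' (rtgt k) = b),
        (φ (rtgt k) - φ (rsrc k)) ^ 2
      ≤ ∑ b ∈ ({rblk L R' (rsrc k)} : Finset _), (φ (rtgt k) - φ (rsrc k)) ^ 2 :=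
        Finset.sum_le_sum_of_subset_of_nonneg hsub fun _ _ _ => sq_nonneg _
    _ = (φ (rtgt k) - φ (rsrc k)) ^ 2 := Finset.sum_singleton _ _

/-- the crossing energies over all ordered pairs add up to at most twice the total bond energy. [folklore] -/
theorem sum_crossEnergy_le (φ : ↥R' → ℝ) :
    ∑ x : ↥(R'.image (blk L)), ∑ y : ↥(R'.image (blk L)), ∑ k ∈ Finset.univ.filter (fun k : RBond R' =>
        (rblk L R' (rsrc k) = x ∧ rblk L R' (rtgt k) = y) ∨ (rblk L R' (rsrc k) = y ∧ rblk L R' (rtgt k) = x)),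
          (φ (rtgt k) - φ (rsrc k)) ^ 2 ≤
      2 * ∑ k : RBond R', (φ (rtgt k) - φ (rsrc k)) ^ 2 := by
  classical
  have hk : ∀ k : RBond R', ∑ x : ↥(R'.image (blk L)), ∑ y : ↥(R'.image (blk L)),
      (if (rblk L R' (rsrc k) = x ∧ rblk L R' (rtgt k) = y) ∨ (rblk L R' (rsrc k) = y ∧ rblk L R' (rtgt k) = x)
        then (φ (rtgt k) - φ (rsrc k)) ^ 2 else 0) ≤ 2 * (φ (rtgt k) - φ (rsrc k)) ^ 2 := by
    intro k
    set g := (φ (rtgt k) - φ (rsrc k)) ^ 2 with hg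
    have h0 : 0 ≤ g := sq_nonneg _
    have hle : ∀ x y : ↥(R'.image (blk L)),
        (if (rblk L R' (rsrc k) = x ∧ rblk L R' (rtgt k) = y) ∨ (rblk L R' (rsrc k) = y ∧ rblk L R' (rtgt k) = x)
          then g else 0) ≤
          (if rblk L R' (rtgt k) = y then (if rblk L R' (rsrc k) = x then g else 0) else 0) +
            (if rblk L R' (rsrc k) = y then (if rblk L R' (rtgt k) = x then g else 0) else 0) := by
      intro x y
      split_ifs <;> first | linarith | tauto
    refine (Finset.sum_le_sum fun x _ => Finset.sum_le_sum fun y _ => hle x y).trans ?_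
    simp only [Finset.sum_add_distrib, Finset.sum_ite_eq, Finset.mem_univ, if_true]
    linarith
  calc ∑ x : ↥(R'.image (blk L)), ∑ y : ↥(R'.image (blk L)), ∑ k ∈ Finset.univ.filter (fun k : RBond R' =>
        (rblk L R' (rsrc k) = x ∧ rblk L R' (rtgt k) = y) ∨ (rblk L R' (rsrc k) = y ∧ rblk L R' (rtgt k) = x)),
          (φ (rtgt k) - φ (rsrc k)) ^ 2
      = ∑ x : ↥(R'.image (blk L)), ∑ y : ↥(R'.image (blk L)), ∑ k : RBond R',
          (if (rblk L R' (rsrc k) = x ∧ rblk L R' (rtgt k) = y) ∨ (rblk L R' (rsrc k) = y ∧ rblk L R' (rtgt k) = x)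
            then (φ (rtgt k) - φ (rsrc k)) ^ 2 else 0) := by
        refine Finset.sum_congr rfl fun x _ => Finset.sum_congr rfl fun y _ => ?_
        rw [Finset.sum_filter]
    _ = ∑ x : ↥(R'.image (blk L)), ∑ k : RBond R', ∑ y : ↥(R'.image (blk L)),
          (if (rblk L R' (rsrc k) = x ∧ rblk L R' (rtgt k) = y) ∨ (rblk L R' (rsrc k) = y ∧ rblk L R' (rtgt k) = x)
            then (φ (rtgt k) - φ (rsrc k)) ^ 2 else 0) := Finset.sum_congr rfl fun x _ => Finset.sum_comm
    _ = ∑ k : RBond R', ∑ x : ↥(R'.image (blk L)), ∑ y : ↥(R'.image (blk L)),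
          (if (rblk L R' (rsrc k) = x ∧ rblk L R' (rtgt k) = y) ∨ (rblk L R' (rsrc k) = y ∧ rblk L R' (rtgt k) = x)
            then (φ (rtgt k) - φ (rsrc k)) ^ 2 else 0) := Finset.sum_comm
    _ ≤ ∑ k : RBond R', 2 * (φ (rtgt k) - φ (rsrc k)) ^ 2 := Finset.sum_le_sum fun k _ => hk k
    _ = 2 * ∑ k : RBond R', (φ (rtgt k) - φ (rsrc k)) ^ 2 := by rw [Finset.mul_sum]

variable [NeZero L]

/-- the last in-block offset in direction `i`: `j_* = (L−1)·e_i`. [folklore] -/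
theorem lastOffset_spec (i : Fin (d + 1)) :
    ∃ j : Fin (d + 1) → Fin L, (∀ ν, ν ≠ i → (j ν : ℕ) = 0) ∧ (j i : ℕ) = L - 1 :=
  ⟨fun ν => if ν = i then ⟨L - 1, by have := NeZero.one_le (n := L); omega⟩ else ⟨0, NeZero.pos L⟩,
    fun ν hν => by simp [hν], by simp⟩

/-- the fine point `L•x + (L−1)e_i` plus `e_i` is the anchor `L•(x + e_i)` of the next block. [folklore] -/
theorem finePt_last_add_uvec (x : Fin (d + 1) → ℤ) (i : Fin (d + 1)) {j : Fin (d + 1) → Fin L}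
    (hj0 : ∀ ν, ν ≠ i → (j ν : ℕ) = 0) (hji : (j i : ℕ) = L - 1) :
    B4Green244.finePt L x j + uvec i = B4Green244.finePt L (x + uvec i) 0 := by
  have hL : 1 ≤ L := NeZero.one_le
  ext ν
  by_cases hν : ν = i
  · subst hν
    simp only [B4Green244.finePt, Pi.add_apply, uvec_apply_same, hji, Pi.zero_apply, Fin.val_zero, Nat.cast_zero,
      add_zero, mul_add, mul_one]
    push_cast [Nat.cast_sub hL]
    ring
  · simp only [B4Green244.finePt, Pi.add_apply, uvec_apply_ne hν, hj0 ν hν, Nat.cast_zero, add_zero, Pi.zero_apply,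
      Fin.val_zero]

/-- **A CROSSING BOND**: for coarse nearest neighbours `x ~ y` in `R = R′.image (blk L)` there is a fine bond of `R′` with one
end in block `x` and the other in block `y`. [folklore] -/
theorem exists_cross_bond (hR'L : IsBlockUnion L R') (x y : ↥(R'.image (blk L))) (hxy : y.1 ∈ nbrs x.1) :
    ∃ k : RBond R', (rblk L R' (rsrc k) = x ∧ rblk L R' (rtgt k) = y) ∨ (rblk L R' (rsrc k) = y ∧ rblk L R' (rtgt k) = x) := by
  have hL : 1 ≤ L := NeZero.one_le
  obtain ⟨i, hi | hi⟩ := mem_nbrs.1 hxy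
  · -- `y = x + e_i`: the bond from `L•x + (L−1)e_i` (block `x`) to `L•y` (block `y`)
    obtain ⟨j, hj0, hji⟩ := lastOffset_spec (L := L) i
    have hy : y.1 = x.1 + uvec i := hi
    have hmem : (rchart hL hR'L x j).1 + uvec i ∈ R' := by
      have : (rchart hL hR'L x j).1 + uvec i = (rchart hL hR'L y 0).1 := by
        show B4Green244.finePt L x.1 j + uvec i = B4Green244.finePt L y.1 0
        rw [finePt_last_add_uvec x.1 i hj0 hji, hy]
      rw [this]; exact (rchart hL hR'L y 0).2
    refine ⟨⟨(rchart hL hR'L x j, i), hmem⟩, Or.inl ⟨rblk_rchart hL hR'L x j, ?_⟩⟩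
    apply Subtype.ext
    show blk L (B4Green244.finePt L x.1 j + uvec i) = y.1
    rw [finePt_last_add_uvec x.1 i hj0 hji, blk_finePt hL, hy]
  · -- `y = x − e_i`, i.e. `x = y + e_i`: the bond from `L•y + (L−1)e_i` (block `y`) to `L•x` (block `x`)
    obtain ⟨j, hj0, hji⟩ := lastOffset_spec (L := L) i
    have hx : x.1 = y.1 + uvec i := by have h : y.1 = x.1 - uvec i := hi; rw [h, sub_add_cancel]
    have hmem : (rchart hL hR'L y j).1 + uvec i ∈ R' := by
      have : (rchart hL hR'L y j).1 + uvec i = (rchart hL hR'L x 0).1 := by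
        show B4Green244.finePt L y.1 j + uvec i = B4Green244.finePt L x.1 0
        rw [finePt_last_add_uvec y.1 i hj0 hji, hx]
      rw [this]; exact (rchart hL hR'L x 0).2
    refine ⟨⟨(rchart hL hR'L y j, i), hmem⟩, Or.inr ⟨rblk_rchart hL hR'L y j, ?_⟩⟩
    apply Subtype.ext
    show blk L (B4Green244.finePt L y.1 j + uvec i) = x.1
    rw [finePt_last_add_uvec y.1 i hj0 hji, blk_finePt hL, hx]

/-- a fine function with block sums `L^{d+1}V_b` has block means `V_b`. [folklore] -/
theorem avg_block_eq (hR'L : IsBlockUnion L R') (φ : ↥R' → ℝ) (V : ↥(R'.image (blk L)) → ℝ)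
    (hφ : ∀ b, ∑ x' ∈ Finset.univ.filter (fun x' => rblk L R' x' = b), φ x' = (L : ℝ) ^ (d + 1) * V b)
    (b : ↥(R'.image (blk L))) : avg (Finset.univ.filter fun x' => rblk L R' x' = b) φ = V b := by
  have hL : 1 ≤ L := NeZero.one_le
  have hL0 : (L : ℝ) ^ (d + 1) ≠ 0 := pow_ne_zero _ (by exact_mod_cast (NeZero.ne L))
  rw [avg, hφ b, card_filter_rblk hL hR'L b]
  push_cast
  field_simp

/-- **ONE POINT AGAINST ITS BLOCK MEAN**: `(φ(p) − V_{blk p})² ≤ (L²∕2)·E_{blk p}`. [folklore] -/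
theorem sq_sub_blockMean_le (hR'L : IsBlockUnion L R') (φ : ↥R' → ℝ) (V : ↥(R'.image (blk L)) → ℝ)
    (hφ : ∀ b, ∑ x' ∈ Finset.univ.filter (fun x' => rblk L R' x' = b), φ x' = (L : ℝ) ^ (d + 1) * V b) (p : ↥R') :
    (φ p - V (rblk L R' p)) ^ 2 ≤ (L : ℝ) ^ 2 / 2 *
      ∑ k ∈ Finset.univ.filter (fun k : RBond R' => rblk L R' (rsrc k) = rblk L R' p ∧ rblk L R' (rtgt k) = rblk L R' p),
        (φ (rtgt k) - φ (rsrc k)) ^ 2 := by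
  classical
  have h1 : (φ p - V (rblk L R' p)) ^ 2 ≤
      ∑ i ∈ Finset.univ.filter (fun i => rblk L R' i = rblk L R' p), (φ i - V (rblk L R' p)) ^ 2 :=
    Finset.single_le_sum (f := fun i => (φ i - V (rblk L R' p)) ^ 2) (fun _ _ => sq_nonneg _)
      (Finset.mem_filter.2 ⟨Finset.mem_univ _, rfl⟩)
  have h2 := blockPoincare_fine hR'L (rblk L R' p) φ
  rw [avg_block_eq hR'L φ V hφ] at h2
  exact h1.trans h2

/-- **THE PAIR BOUND**: for coarse nearest neighbours `x ~ y`,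
`(V_x − V_y)² ≤ 3·((L²∕2)(E_x + E_y) + E_{x,y})`. [folklore] -/
theorem pair_sq_le (hR'L : IsBlockUnion L R') (φ : ↥R' → ℝ) (V : ↥(R'.image (blk L)) → ℝ)
    (hφ : ∀ b, ∑ x' ∈ Finset.univ.filter (fun x' => rblk L R' x' = b), φ x' = (L : ℝ) ^ (d + 1) * V b)
    (x y : ↥(R'.image (blk L))) (hxy : y.1 ∈ nbrs x.1) :
    (V x - V y) ^ 2 ≤ 3 * ((L : ℝ) ^ 2 / 2 *
      (∑ k ∈ Finset.univ.filter (fun k : RBond R' => rblk L R' (rsrc k) = x ∧ rblk L R' (rtgt k) = x),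
          (φ (rtgt k) - φ (rsrc k)) ^ 2 +
        ∑ k ∈ Finset.univ.filter (fun k : RBond R' => rblk L R' (rsrc k) = y ∧ rblk L R' (rtgt k) = y),
          (φ (rtgt k) - φ (rsrc k)) ^ 2) +
      ∑ k ∈ Finset.univ.filter (fun k : RBond R' =>
          (rblk L R' (rsrc k) = x ∧ rblk L R' (rtgt k) = y) ∨ (rblk L R' (rsrc k) = y ∧ rblk L R' (rtgt k) = x)),
        (φ (rtgt k) - φ (rsrc k)) ^ 2) := by
  classical
  obtain ⟨k, hk⟩ := exists_cross_bond hR'L x y hxy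
  have hcross : (φ (rtgt k) - φ (rsrc k)) ^ 2 ≤ ∑ k ∈ Finset.univ.filter (fun k : RBond R' =>
      (rblk L R' (rsrc k) = x ∧ rblk L R' (rtgt k) = y) ∨ (rblk L R' (rsrc k) = y ∧ rblk L R' (rtgt k) = x)),
        (φ (rtgt k) - φ (rsrc k)) ^ 2 :=
    Finset.single_le_sum (f := fun k : RBond R' => (φ (rtgt k) - φ (rsrc k)) ^ 2) (fun _ _ => sq_nonneg _)
      (Finset.mem_filter.2 ⟨Finset.mem_univ _, hk⟩)
  have hs := sq_sub_blockMean_le hR'L φ V hφ (rsrc k)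
  have ht := sq_sub_blockMean_le hR'L φ V hφ (rtgt k)
  have hEx := blockEnergy_nonneg (L := L) φ x
  have hEy := blockEnergy_nonneg (L := L) φ y
  -- three-term splitting `(a + b + c)² ≤ 3(a² + b² + c²)`
  have h3 : ∀ a b c : ℝ, (a + b + c) ^ 2 ≤ 3 * (a ^ 2 + b ^ 2 + c ^ 2) := fun a b c => by
    nlinarith [sq_nonneg (a - b), sq_nonneg (b - c), sq_nonneg (a - c)]
  rcases hk with ⟨hks, hkt⟩ | ⟨hks, hkt⟩
  · rw [hks] at hs; rw [hkt] at ht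
    have e : V x - V y = (V x - φ (rsrc k)) + -(φ (rtgt k) - φ (rsrc k)) + (φ (rtgt k) - V y) := by ring
    rw [e]
    refine (h3 _ _ _).trans ?_
    rw [neg_sq]
    nlinarith [sq_nonneg (V x - φ (rsrc k)), sq_nonneg (φ (rtgt k) - V y)]
  · rw [hks] at hs; rw [hkt] at ht
    have e : V x - V y = (V x - φ (rtgt k)) + (φ (rtgt k) - φ (rsrc k)) + (φ (rsrc k) - V y) := by ring
    rw [e]
    refine (h3 _ _ _).trans ?_
    nlinarith [sq_nonneg (V x - φ (rtgt k)), sq_nonneg (φ (rsrc k) - V y)]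

/-- **THE COARSE DIRICHLET SUM AGAINST THE FINE BOND ENERGY**: for `φ` with `L`-block sums `L^{d+1}V_b`,
`Σ_xΣ_{y~x}(V_x − V_y)² ≤ (6(d+1)L² + 6)·Σ_k(φ(k₊) − φ(k₋))²`. [folklore] -/
theorem coarseDirichlet_le (hR'L : IsBlockUnion L R') (φ : ↥R' → ℝ) (V : ↥(R'.image (blk L)) → ℝ)
    (hφ : ∀ b, ∑ x' ∈ Finset.univ.filter (fun x' => rblk L R' x' = b), φ x' = (L : ℝ) ^ (d + 1) * V b) :
    ∑ x : ↥(R'.image (blk L)), ∑ y : ↥(R'.image (blk L)), (if y.1 ∈ nbrs x.1 then (V x - V y) ^ 2 else 0) ≤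
      (6 * ((d : ℝ) + 1) * (L : ℝ) ^ 2 + 6) * ∑ k : RBond R', (φ (rtgt k) - φ (rsrc k)) ^ 2 := by
  classical
  set E : ↥(R'.image (blk L)) → ℝ := fun b => ∑ k ∈ Finset.univ.filter
    (fun k : RBond R' => rblk L R' (rsrc k) = b ∧ rblk L R' (rtgt k) = b), (φ (rtgt k) - φ (rsrc k)) ^ 2 with hE
  set X : ↥(R'.image (blk L)) → ↥(R'.image (blk L)) → ℝ := fun x y => ∑ k ∈ Finset.univ.filter (fun k : RBond R' =>
    (rblk L R' (rsrc k) = x ∧ rblk L R' (rtgt k) = y) ∨ (rblk L R' (rsrc k) = y ∧ rblk L R' (rtgt k) = x)),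
      (φ (rtgt k) - φ (rsrc k)) ^ 2 with hX
  set Etot := ∑ k : RBond R', (φ (rtgt k) - φ (rsrc k)) ^ 2 with hEtot
  have hEnn : ∀ b, 0 ≤ E b := fun b => blockEnergy_nonneg φ b
  have hXnn : ∀ x y, 0 ≤ X x y := fun x y => Finset.sum_nonneg fun _ _ => sq_nonneg _
  -- termwise pair bound
  have hterm : ∀ x y : ↥(R'.image (blk L)), (if y.1 ∈ nbrs x.1 then (V x - V y) ^ 2 else 0) ≤
      (if y.1 ∈ nbrs x.1 then 3 * ((L : ℝ) ^ 2 / 2) * E x else 0) +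
        (if y.1 ∈ nbrs x.1 then 3 * ((L : ℝ) ^ 2 / 2) * E y else 0) + 3 * X x y := by
    intro x y
    split_ifs with h
    · have := pair_sq_le hR'L φ V hφ x y h
      simp only [hE, hX] at this ⊢
      linarith
    · have := hXnn x y; simp only [hX] at this ⊢; linarith
  refine (Finset.sum_le_sum fun x _ => Finset.sum_le_sum fun y _ => hterm x y).trans ?_
  simp_rw [Finset.sum_add_distrib]
  have hA := sum_nbr_left_le (R'.image (blk L)) (fun x => 3 * ((L : ℝ) ^ 2 / 2) * E x)
    (fun x => by have := hEnn x; positivity)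
  have hB := sum_nbr_right_le (R'.image (blk L)) (fun x => 3 * ((L : ℝ) ^ 2 / 2) * E x)
    (fun x => by have := hEnn x; positivity)
  have hC : ∑ x : ↥(R'.image (blk L)), ∑ y : ↥(R'.image (blk L)), 3 * X x y ≤ 3 * (2 * Etot) := by
    rw [show ∑ x : ↥(R'.image (blk L)), ∑ y : ↥(R'.image (blk L)), 3 * X x y =
      3 * ∑ x : ↥(R'.image (blk L)), ∑ y : ↥(R'.image (blk L)), X x y by simp_rw [Finset.mul_sum]]
    exact mul_le_mul_of_nonneg_left (sum_crossEnergy_le φ) (by norm_num)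
  have hD : ∑ x : ↥(R'.image (blk L)), 3 * ((L : ℝ) ^ 2 / 2) * E x ≤ 3 * ((L : ℝ) ^ 2 / 2) * Etot := by
    rw [← Finset.mul_sum]
    exact mul_le_mul_of_nonneg_left (sum_blockEnergy_le φ) (by positivity)
  have hEtot_nn : 0 ≤ Etot := Finset.sum_nonneg fun _ _ => sq_nonneg _
  have hd : (0 : ℝ) ≤ d := Nat.cast_nonneg d
  nlinarith [hA, hB, hC, hD, mul_nonneg hd hEtot_nn, mul_nonneg (mul_nonneg hd (sq_nonneg (L : ℝ))) hEtot_nn,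
    mul_nonneg (sq_nonneg (L : ℝ)) hEtot_nn]

end Coarse

end Summit.QuantumFields.BalabanUV.T4Continuum.NE7K1LinTwoRunBonds
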